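import Literature.Geometry.Kaehler.GradedFormsLefschetzStrings
import Literature.Geometry.Kaehler.ComplexTorusFourierPrimitiveStrings
import Literature.Geometry.Kaehler.ComplexTorusLefschetzSL2Action
import Literature.Algebra.Lie.LefschetzModuleSL2RepresentationStrings
import Literature.Algebra.Lie.LefschetzModuleSL2RepresentationIntertwiners
import HarnessLib

/-!
# Beauville 2010 §5 on `H•(X; ℂ)`: the `SL₂(ℂ)`-stable subspaces, the irreducible string of a primitive class, the
# decomposition into strings, the `SL₂(ℂ)`-invariants and the lowest weight vectors of a polarised complex torus

Layer `Literature/Geometry/Kaehler`, namespace `Literature.Geometry.Kaehler.ComplexTorus`; lane `lit-hodgefound` (Track 2 foundations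
library), prover seat `lit-hodgefound-p09` (generation 52, row g52-#7). THEOREMS ONLY (no definition, no named fact, no instance, no
notation; D-0026 net debt `0`). The GROUP-LEVEL companion of row g21-#4 `GradedFormsLefschetzStrings` (the `𝔰𝔩₂`-strings
`Span{of (k+2s) (Lˢα) | s ≤ g − k}` of the primitive forms as irreducible modules over `ℬ = ℂ[L, Λ, H]`, spanning `H•(X; ℂ)`), through
row g51-#9 `ComplexTorusLefschetzSL2Action` (Beauville's `ρ : SL(2, ℂ) →* End_ℂ(H•(X; ℂ))`) and the abstract rows
`Algebra/Lie/LefschetzModuleSL2RepresentationStrings` (`SL₂(K)`-stable = `𝔰𝔩₂`-stable; Beauville's Proposition), `…SL2RepresentationIntertwiners`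
(Bourbaki's Theorem 2 (iii): the invariants), `…LowestWeightVectors` (`ker f = ⊕ P_{−k}`).

SETTING. `H•(X; ℂ) = GForm E ℂ`, `η` a non-degenerate real `2`-form on `V = E` (`g = dim_ℂ E`), `L = lefschetzG η`, `Λ = lefschetzDualG η`,
`H = countingG E`, `ρ = (hasLefschetzProperty_lefschetzG hη).sl2Rep isZGrading_countingG`, `w` the Weyl operator, `Pᵏ(η) = primitiveForms η k`,
and for `α ∈ Pᵏ(η)`, `k ≤ g`, THE STRING OF `α` = `Span_ℂ{of (k + 2s) (Lˢα) | s ≤ g − k}` (the family of row g21-#4, written out, no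
definition). Dictionary with Beauville: `z ↔ α`, `θ^q z ↔ L^q α`, "primitive: `θ^{g−1} ∗ z = 0`" ↔ `Λ_η α = 0`, `g + s − 2p ↔ g − k`.

## What is proved

* §1 **`forall_sl2Rep_apply_mem_iff`: a `ℂ`-subspace `U ⊆ H•(X; ℂ)` is `ρ(SL₂(ℂ))`-stable iff it is stable under `L_η` and `Λ_η`**
  (then under `H`, under the whole Lefschetz algebra `ℬ`, and it is GRADED: `countingG_apply_mem_of_sl2Rep_stable`,
  `apply_mem_of_mem_adjoin_lefschetz_of_sl2Rep_stable`, `of_apply_mem_of_sl2Rep_stable`, `forall_sl2Rep_apply_mem_iff_forall_mem_adjoin`).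
* §2 **THE STRING OF A PRIMITIVE CLASS IS AN IRREDUCIBLE SUBREPRESENTATION**: `sl2Rep_apply_mem_span_string` ("The subspace … spanned by
  the `θ^q z` is a[n `SL₂`-sub]representation"), `weylOperator_apply_mem_span_string`, `span_string_le_of_sl2Rep_stable` (it is the
  subrepresentation generated by `of k α`), `span_string_eq_span_pow_apply` (= the abstract string `Span{Lˢ(of k α)}`),
  **`eq_span_string_of_sl2Rep_stable`** (a non-zero `ρ`-stable subspace of the string is the string: "irreducible representation of `SL₂`";
  with g21-#4's `finrank_span_range_of_lefschetzPow`: "(`z, θz, …, θ^{g+s−2p} z`) is a basis").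
* §3 **`biSup_span_string_eq_top`: "The vector space `CH(A)` is a direct sum of subrepresentations of this type"** — the strings of the
  non-zero primitive classes of degree `≤ g` span `H•(X; ℂ)` (directness = the Lefschetz decomposition of g21-#4 / `lefschetzSummand_induction`).
* §4 INVARIANTS AND LOWEST WEIGHTS: **`forall_sl2Rep_apply_eq_self_iff`: `ρ(γ) x = x ∀ γ ⟺ x = of g α` with `α ∈ Pᵍ(η)`** (the trivial
  subrepresentations are the middle primitive classes; Bourbaki VIII §1 no. 4 Thm. 2 (iii)), `sl2Rep_of_eq_self_of_mem_primitiveForms`,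
  `weylOperator_of_eq_self_of_mem_primitiveForms`; **`lefschetzDualG_apply_eq_zero_iff`: "The primitive elements are exactly the lowest
  weight elements": `Λ_η x = 0 ⟺ x_m ∈ Pᵐ(η)` for `m ≤ g` and `x_m = 0` for `m > g`** ("`g + s − 2p ≥ 0`": `of_eq_zero_of_lefschetzDualG_of_eq_zero_of_lt`),
  `lefschetzDualG_of_eq_zero_iff`, and at group level `forall_sl2Rep_lower_apply_eq_self_iff` (fixed by the lower unipotents `ρ(1 0 ; a 1) =
  exp(a Λ_η)` iff `Λ_η x = 0`).

## Sources, VERBATIM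

* A. Beauville, *The action of SL₂ on abelian varieties*, J. Ramanujan Math. Soc. 25 (2010) [Beauville2010SL2], held text
  `paper:arxiv-0805.1541` p0006 L4–L13, §5: "We say that an element `z ∈ CH^p_s(A)` is primitive if `θ^{g−1} ∗ z = 0`. The primitive
  elements are exactly the lowest weight elements for the action of `SL₂` on `CH(A)`. Let `z ∈ CH^p_s(A)` be a primitive element. The
  subspace of `CH(A)` spanned (over `ℚ`) by the `θ^q z` is an irreducible representation of `SL₂`; it is identified with the space of
  polynomials in one variable of degree `≤ g+s−2p` (with the standard action) by the map `P ↦ P(θ)z`. […] **Proposition** If `z ∈ CH^p_s(A)`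
  is primitive, we have `g+s−2p ≥ 0`, and `(z, θz, …, θ^{g+s−2p} z)` is a basis of an irreducible subrepresentation of `CH(A)`. The vector
  space `CH(A)` is a direct sum of subrepresentations of this type."
* N. Bourbaki, *Lie Groups and Lie Algebras, Chapters 7–9* [Bourbaki2008LieGroups79], Ch. VIII §1 no. 4 Theorem 2 (iii) ("`π(s)x = x` for all
  `s ∈ SL(2, k)` if and only if `x` is invariant under `ρ`") and Proposition 5.
* D. Huybrechts, *Complex Geometry* (2005) [HuybrechtsCG2005], §1.2 proof of Prop. 1.2.30 (i) (PDF p0050): "for any primitive `v` the subspace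
  `v, Lv, L²v, …` defines a subrepresentation".
* B. C. Hall, *Lie Groups, Lie Algebras, and Representations* (2nd ed., 2015) [Hall2015], Prop. 4.5 (invariant subspaces of a connected
  group vs. its Lie algebra) and Thm. 4.32.
-/

noncomputable section

-- `Module ℂ` / `SMulZeroClass ℂ` synthesis on `E [⋀^Fin k]→L[ℝ] ℂ` (as in `ComplexTorusLefschetzDecomposition`)
set_option maxSynthPendingDepth 3

namespace Literature.Geometry.Kaehler

namespace ComplexTorus

open Module Function Finset
open scoped MatrixGroups
open Literature.LinearAlgebra.Alternating Literature.Algebra.Lie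

universe uE

variable {E : Type uE} [NormedAddCommGroup E] [NormedSpace ℂ E] [FiniteDimensional ℂ E] [Nontrivial E] {η : E [⋀^Fin 2]→L[ℝ] ℝ}

/-! ## §1 `SL₂(ℂ)`-stable subspaces of `H•(X; ℂ)` -/

section Stable

/-- **A `ℂ`-subspace of `H•(X; ℂ)` is `ρ(SL₂(ℂ))`-stable iff it is stable under `L_η` and `Λ_η`.** [cite: Hall2015, Prop. 4.5 (pp. 79–80)]
[cite: Beauville2010SL2, §5 (p. 6)] -/
theorem forall_sl2Rep_apply_mem_iff (hη : ∀ v : E, v ≠ 0 → ∃ w : E, η ![v, w] ≠ 0) (U : Submodule ℂ (GForm E ℂ)) :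
    (∀ γ : SL(2, ℂ), ∀ u ∈ U, (hasLefschetzProperty_lefschetzG hη).sl2Rep isZGrading_countingG γ u ∈ U) ↔
      (∀ u ∈ U, lefschetzG η u ∈ U) ∧ ∀ u ∈ U, lefschetzDualG η u ∈ U := by
  rw [(hasLefschetzProperty_lefschetzG hη).forall_sl2Rep_apply_mem_iff isZGrading_countingG U, dual_lefschetzG_eq_lefschetzDualG hη]

/-- An `SL₂(ℂ)`-stable subspace is `H`-stable. [cite: Hall2015, Prop. 4.5] [cite: Beauville2010SL2, §4 Theorem ("Hz = (2p−g−s) z")] -/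
theorem countingG_apply_mem_of_sl2Rep_stable (hη : ∀ v : E, v ≠ 0 → ∃ w : E, η ![v, w] ≠ 0) {U : Submodule ℂ (GForm E ℂ)}
    (hU : ∀ γ : SL(2, ℂ), ∀ u ∈ U, (hasLefschetzProperty_lefschetzG hη).sl2Rep isZGrading_countingG γ u ∈ U) {u : GForm E ℂ} (hu : u ∈ U) :
    countingG E u ∈ U :=
  (hasLefschetzProperty_lefschetzG hη).h_apply_mem_of_sl2Rep_stable isZGrading_countingG hU hu

/-- An `SL₂(ℂ)`-stable subspace is stable under the whole Lefschetz algebra `ℬ = ℂ[L_η, Λ_η, H]`. [cite: Hall2015, Prop. 4.5]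
[cite: GoodmanWallachGTM255, §5.5.1 Thm. 5.5.8 (p. 384)] -/
theorem apply_mem_of_mem_adjoin_lefschetz_of_sl2Rep_stable (hη : ∀ v : E, v ≠ 0 → ∃ w : E, η ![v, w] ≠ 0) {U : Submodule ℂ (GForm E ℂ)}
    (hU : ∀ γ : SL(2, ℂ), ∀ u ∈ U, (hasLefschetzProperty_lefschetzG hη).sl2Rep isZGrading_countingG γ u ∈ U) {A : Module.End ℂ (GForm E ℂ)}
    (hA : A ∈ Algebra.adjoin ℂ {lefschetzG η, lefschetzDualG η, countingG E}) {u : GForm E ℂ} (hu : u ∈ U) : A u ∈ U := by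
  obtain ⟨hL, hΛ⟩ := (forall_sl2Rep_apply_mem_iff hη U).1 hU
  exact apply_mem_of_mem_adjoin_lefschetz_of_stable hη hL hΛ hA u hu

/-- **`SL₂(ℂ)`-stable subspaces are GRADED**: every homogeneous component of a member is a member (the degree projections are polynomials
in `H`). [cite: Beauville2010SL2, §4 Theorem ("Hz = (2p−g−s) z")] [cite: GoodmanWallachGTM255, §5.5.1 (p. 383: "Q_k commutes with G")] -/
theorem of_apply_mem_of_sl2Rep_stable (hη : ∀ v : E, v ≠ 0 → ∃ w : E, η ![v, w] ≠ 0) {U : Submodule ℂ (GForm E ℂ)}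
    (hU : ∀ γ : SL(2, ℂ), ∀ u ∈ U, (hasLefschetzProperty_lefschetzG hη).sl2Rep isZGrading_countingG γ u ∈ U) {u : GForm E ℂ} (hu : u ∈ U)
    (m : ℕ) : GForm.of m (u m) ∈ U := by
  obtain ⟨hL, hΛ⟩ := (forall_sl2Rep_apply_mem_iff hη U).1 hU
  exact of_apply_mem_of_stable hη hL hΛ hu m

/-- **`ρ(SL₂(ℂ))`-stable ⟺ `ℬ`-stable** (`ρ(γ) ∈ ℂ[L_η, Λ_η]`). [cite: Hall2015, Prop. 4.5] [cite: GoodmanWallachGTM255, §5.5.1 Thm. 5.5.8] -/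
theorem forall_sl2Rep_apply_mem_iff_forall_mem_adjoin (hη : ∀ v : E, v ≠ 0 → ∃ w : E, η ![v, w] ≠ 0) (U : Submodule ℂ (GForm E ℂ)) :
    (∀ γ : SL(2, ℂ), ∀ u ∈ U, (hasLefschetzProperty_lefschetzG hη).sl2Rep isZGrading_countingG γ u ∈ U) ↔
      ∀ A ∈ Algebra.adjoin ℂ {lefschetzG η, lefschetzDualG η, countingG E}, ∀ u ∈ U, A u ∈ U := by
  refine ⟨fun hU A hA u hu ↦ apply_mem_of_mem_adjoin_lefschetz_of_sl2Rep_stable hη hU hA hu, fun hU ↦ (forall_sl2Rep_apply_mem_iff hη U).2 ⟨?_, ?_⟩⟩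
  · exact hU _ (Algebra.subset_adjoin (by simp))
  · exact hU _ (Algebra.subset_adjoin (by simp))

end Stable

/-! ## §2 The string of a primitive class is an irreducible `SL₂(ℂ)`-subrepresentation -/

section Strings

omit [FiniteDimensional ℂ E] [Nontrivial E] in
/-- **The string is the abstract string**: `Span{of (k+2s) (Lˢα)} = Span{L_ηˢ (of k α)}` (`Lˢ(of k α) = of (k+2s)(Lˢα)`). [cite: Beauville2010SL2, §5 (p. 6, "θ^q z")] -/
theorem span_string_eq_span_pow_apply (η : E [⋀^Fin 2]→L[ℝ] ℝ) (k : ℕ) (α : E [⋀^Fin k]→L[ℝ] ℂ) :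
    Submodule.span ℂ (Set.range fun s : Fin (finrank ℂ E - k + 1) ↦
        GForm.of (k + 2 * (s : ℕ)) (lefschetzPow η s (add_comm (2 * (s : ℕ)) k) α)) =
      Submodule.span ℂ (Set.range fun s : Fin (finrank ℂ E - k + 1) ↦ (lefschetzG η ^ (s : ℕ)) (GForm.of k α)) := by
  congr 2
  funext s
  rw [lefschetzG_pow_of η s (add_comm (2 * (s : ℕ)) k) α]

/-- **"The subspace of `CH(A)` spanned by the `θ^q z` is a[n `SL₂`-sub]representation"**: the string of a primitive class `α ∈ Pᵏ(η)`,
`k ≤ g`, is stable under every `ρ(γ)`, `γ ∈ SL₂(ℂ)` (it is `L_η`- and `Λ_η`-stable, row g21-#4). [cite: Beauville2010SL2, §5 Proposition (p. 6)]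
[cite: HuybrechtsCG2005, §1.2 proof of Prop. 1.2.30 (i) (PDF p0050)] -/
theorem sl2Rep_apply_mem_span_string (hη : ∀ v : E, v ≠ 0 → ∃ w : E, η ![v, w] ≠ 0) {k : ℕ} (hk : k ≤ finrank ℂ E)
    {α : E [⋀^Fin k]→L[ℝ] ℂ} (hα : α ∈ primitiveForms η k) (γ : SL(2, ℂ)) :
    ∀ w ∈ Submodule.span ℂ (Set.range fun s : Fin (finrank ℂ E - k + 1) ↦
        GForm.of (k + 2 * (s : ℕ)) (lefschetzPow η s (add_comm (2 * (s : ℕ)) k) α)),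
      (hasLefschetzProperty_lefschetzG hη).sl2Rep isZGrading_countingG γ w ∈ Submodule.span ℂ (Set.range fun s : Fin (finrank ℂ E - k + 1) ↦
        GForm.of (k + 2 * (s : ℕ)) (lefschetzPow η s (add_comm (2 * (s : ℕ)) k) α)) :=
  (forall_sl2Rep_apply_mem_iff hη _).2 ⟨lefschetzG_apply_mem_span_string hk hα, lefschetzDualG_apply_mem_span_string hη hk hα⟩ γ

/-- The string of a primitive class is stable under the Weyl operator `w = ρ(0 −1 ; 1 0)` (Beauville's `ℱ`). [cite: Beauville2010SL2, §4 Theorem and §5 Corollary (p. 6)] -/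
theorem weylOperator_apply_mem_span_string (hη : ∀ v : E, v ≠ 0 → ∃ w : E, η ![v, w] ≠ 0) {k : ℕ} (hk : k ≤ finrank ℂ E)
    {α : E [⋀^Fin k]→L[ℝ] ℂ} (hα : α ∈ primitiveForms η k) :
    ∀ x ∈ Submodule.span ℂ (Set.range fun s : Fin (finrank ℂ E - k + 1) ↦
        GForm.of (k + 2 * (s : ℕ)) (lefschetzPow η s (add_comm (2 * (s : ℕ)) k) α)),
      (hasLefschetzProperty_lefschetzG hη).weylOperator isZGrading_countingG x ∈ Submodule.span ℂ (Set.range fun s : Fin (finrank ℂ E - k + 1) ↦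
        GForm.of (k + 2 * (s : ℕ)) (lefschetzPow η s (add_comm (2 * (s : ℕ)) k) α)) := by
  intro x hx
  rw [← (hasLefschetzProperty_lefschetzG hη).sl2Rep_apply_of_coe_eq_weyl isZGrading_countingG
    (⟨!![(0 : ℂ), -1; 1, 0], by rw [Matrix.det_fin_two_of]; ring⟩ : SL(2, ℂ)) rfl]
  exact sl2Rep_apply_mem_span_string hη hk hα _ x hx

/-- **The string is the subrepresentation GENERATED by `of k α`**: every `ρ(SL₂(ℂ))`-stable subspace containing `of k α` contains the
string (it is `L_η`-stable). [cite: Beauville2010SL2, §5 (p. 6)] -/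
theorem span_string_le_of_sl2Rep_stable (hη : ∀ v : E, v ≠ 0 → ∃ w : E, η ![v, w] ≠ 0) {k : ℕ} (α : E [⋀^Fin k]→L[ℝ] ℂ)
    {U : Submodule ℂ (GForm E ℂ)} (hU : ∀ γ : SL(2, ℂ), ∀ u ∈ U, (hasLefschetzProperty_lefschetzG hη).sl2Rep isZGrading_countingG γ u ∈ U)
    (hαU : GForm.of k α ∈ U) :
    Submodule.span ℂ (Set.range fun s : Fin (finrank ℂ E - k + 1) ↦
        GForm.of (k + 2 * (s : ℕ)) (lefschetzPow η s (add_comm (2 * (s : ℕ)) k) α)) ≤ U := by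
  obtain ⟨hL, -⟩ := (forall_sl2Rep_apply_mem_iff hη U).1 hU
  have hpow : ∀ n : ℕ, (lefschetzG η ^ n) (GForm.of k α) ∈ U := fun n ↦ by
    induction n with
    | zero => rwa [pow_zero, Module.End.one_apply]
    | succ n ih => rw [pow_succ', Module.End.mul_apply]; exact hL _ ih
  refine Submodule.span_le.2 ?_
  rintro _ ⟨s, rfl⟩
  change GForm.of (k + 2 * (s : ℕ)) (lefschetzPow η s (add_comm (2 * (s : ℕ)) k) α) ∈ U
  rw [← lefschetzG_pow_of η s (add_comm (2 * (s : ℕ)) k) α]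
  exact hpow s

/-- **IRREDUCIBILITY — "an irreducible representation of `SL₂`"**: a non-zero `ρ(SL₂(ℂ))`-stable subspace of the string of a primitive class
`α ∈ Pᵏ(η)` (`k ≤ g`) is the whole string. (With row g21-#4's `finrank_span_range_of_lefschetzPow`: "(`z, θz, …, θ^{g+s−2p} z`) is a basis of an
irreducible subrepresentation".) [cite: Beauville2010SL2, §5 Proposition (p. 6)] [cite: Hall2015, Prop. 4.5 and Thm. 4.32] -/
theorem eq_span_string_of_sl2Rep_stable (hη : ∀ v : E, v ≠ 0 → ∃ w : E, η ![v, w] ≠ 0) {k : ℕ} (hk : k ≤ finrank ℂ E)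
    {α : E [⋀^Fin k]→L[ℝ] ℂ} (hα : α ∈ primitiveForms η k) {U : Submodule ℂ (GForm E ℂ)}
    (hUS : U ≤ Submodule.span ℂ (Set.range fun s : Fin (finrank ℂ E - k + 1) ↦
        GForm.of (k + 2 * (s : ℕ)) (lefschetzPow η s (add_comm (2 * (s : ℕ)) k) α)))
    (hU : ∀ γ : SL(2, ℂ), ∀ u ∈ U, (hasLefschetzProperty_lefschetzG hη).sl2Rep isZGrading_countingG γ u ∈ U) (hU0 : U ≠ ⊥) :
    U = Submodule.span ℂ (Set.range fun s : Fin (finrank ℂ E - k + 1) ↦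
        GForm.of (k + 2 * (s : ℕ)) (lefschetzPow η s (add_comm (2 * (s : ℕ)) k) α)) := by
  rw [span_string_eq_span_pow_apply] at hUS ⊢
  exact (hasLefschetzProperty_lefschetzG hη).eq_span_string_of_sl2Rep_stable isZGrading_countingG
    (of_mem_primitiveSpace_of_mem_primitiveForms hη (show k + (finrank ℂ E - k) = finrank ℂ E by omega) hα) hUS hU hU0

end Strings

/-! ## §3 "The vector space `CH(A)` is a direct sum of subrepresentations of this type" -/

section Decomposition

omit [Nontrivial E] in
/-- **The strings of the non-zero primitive classes of degree `≤ g` span `H•(X; ℂ)`** — every class is a sum of its homogeneous components,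
each a sum `Σ Lʳβᵣ` of Lefschetz summands with `βᵣ` primitive (`lefschetzSummand_induction`), and `of m (Lʳβ)` lies on the string of `β`.
[cite: Beauville2010SL2, §5 Proposition (p. 6)] [cite: HuybrechtsCG2005, §1.2 Prop. 1.2.30 (i)] -/
theorem biSup_span_string_eq_top (hη : ∀ v : E, v ≠ 0 → ∃ w : E, η ![v, w] ≠ 0) :
    ⨆ i ∈ {i : (k : ℕ) × (E [⋀^Fin k]→L[ℝ] ℂ) | i.1 ≤ finrank ℂ E ∧ i.2 ∈ primitiveForms η i.1 ∧ i.2 ≠ 0},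
      Submodule.span ℂ (Set.range fun s : Fin (finrank ℂ E - i.1 + 1) ↦
        GForm.of (i.1 + 2 * (s : ℕ)) (lefschetzPow η s (add_comm (2 * (s : ℕ)) i.1) i.2)) = ⊤ := by
  refine eq_top_iff.2 fun w _ ↦ ?_
  rw [← sum_range_of_eq w]
  refine Submodule.sum_mem _ fun m hm ↦ ?_
  have hm' : m ≤ 2 * finrank ℂ E := by have := Finset.mem_range.1 hm; omega
  refine lefschetzSummand_induction hη hm' (C := fun x ↦ GForm.of m x ∈ _) (fun r k h hmr β hβ ↦ ?_) ?_ (fun x y hx hy ↦ ?_) (w m)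
  · by_cases hβ0 : β = 0
    · rw [hβ0, map_zero, GForm.of_zero]; exact Submodule.zero_mem _
    have hk : k ≤ finrank ℂ E := by omega
    by_cases hr : r ≤ finrank ℂ E - k
    · refine Submodule.mem_iSup_of_mem ⟨k, β⟩ (Submodule.mem_iSup_of_mem ⟨hk, hβ, hβ0⟩ ?_)
      dsimp only
      refine Submodule.subset_span ⟨⟨r, by omega⟩, ?_⟩
      change GForm.of (k + 2 * r) (lefschetzPow η r (add_comm (2 * r) k) β) = GForm.of m (lefschetzPow η r h β)
      rw [← lefschetzG_pow_of η r h β, lefschetzG_pow_of η r (add_comm (2 * r) k) β]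
    · rw [lefschetzPow_eq_zero_of_mem_primitiveForms (show k + (finrank ℂ E - k) = finrank ℂ E by omega)
        (show finrank ℂ E - k < r by omega) h hβ, GForm.of_zero]
      exact Submodule.zero_mem _
  · rw [GForm.of_zero]; exact Submodule.zero_mem _
  · rw [GForm.of_add]; exact Submodule.add_mem _ hx hy

end Decomposition

/-! ## §4 The `SL₂(ℂ)`-invariants and the lowest weight vectors -/

section Invariants

/-- `P_{−n}` of the abstract Lefschetz module `H•(X; ℂ)` consists of the classes `of (g−n) α`, `α ∈ P^{g−n}(η)` (`n ≤ g`). [cite: Beauville2010SL2, §5 (p. 6)] -/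
theorem mem_primitiveSpace_iff_exists_of (hη : ∀ v : E, v ≠ 0 → ∃ w : E, η ![v, w] ≠ 0) {n : ℕ} (hn : n ≤ finrank ℂ E) {p : GForm E ℂ} :
    p ∈ HasLefschetzProperty.primitiveSpace (countingG E) (lefschetzG η) n ↔
      ∃ α ∈ primitiveForms η (finrank ℂ E - n), p = GForm.of (finrank ℂ E - n) α := by
  constructor
  · intro hp
    have hd := (HasLefschetzProperty.mem_primitiveSpace_iff.1 hp).1
    rw [show (-(n : ℤ)) = ((finrank ℂ E - n : ℕ) : ℤ) - (finrank ℂ E : ℤ) by omega, mem_degreeSpace_countingG_iff] at hd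
    refine ⟨p (finrank ℂ E - n), ?_, hd.eq_of⟩
    have hp' := hp
    rw [hd.eq_of] at hp'
    exact (of_mem_primitiveSpace_iff_mem_primitiveForms hη (show finrank ℂ E - n + n = finrank ℂ E by omega) _).1 hp'
  · rintro ⟨α, hα, rfl⟩
    exact of_mem_primitiveSpace_of_mem_primitiveForms hη (by omega) hα

omit [FiniteDimensional ℂ E] [Nontrivial E] in
/-- Above the middle there are no lowest weight vectors: `P_{−n} = 0` for `n > g` ("`g + s − 2p ≥ 0`"). [cite: Beauville2010SL2, §5 Proposition (p. 6)] -/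
theorem primitiveSpace_eq_bot_of_lt {n : ℕ} (hn : finrank ℂ E < n) :
    HasLefschetzProperty.primitiveSpace (countingG E) (lefschetzG η) n = ⊥ := by
  refine eq_bot_iff.2 fun p hp ↦ ?_
  have hd := (HasLefschetzProperty.mem_primitiveSpace_iff.1 hp).1
  rw [degreeSpace_countingG_eq_bot_of_lt (by omega)] at hd
  exact hd

/-- **THE `SL₂(ℂ)`-INVARIANTS OF `H•(X; ℂ)` ARE THE MIDDLE PRIMITIVE CLASSES**: `ρ(γ) x = x` for all `γ ∈ SL₂(ℂ)` iff `x = of g α` with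
`α ∈ Pᵍ(η)` (the trivial subrepresentations `V(0)` are the weight-`0` lowest weight vectors, `P₀ = Pᵍ(η)` in degree `g`).
[cite: Bourbaki2008LieGroups79, Ch. VIII §1 no. 4 Theorem 2 (iii)] [cite: Beauville2010SL2, §5 Proposition (p. 6)] -/
theorem forall_sl2Rep_apply_eq_self_iff (hη : ∀ v : E, v ≠ 0 → ∃ w : E, η ![v, w] ≠ 0) (x : GForm E ℂ) :
    (∀ γ : SL(2, ℂ), (hasLefschetzProperty_lefschetzG hη).sl2Rep isZGrading_countingG γ x = x) ↔
      ∃ α ∈ primitiveForms η (finrank ℂ E), x = GForm.of (finrank ℂ E) α := by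
  rw [(hasLefschetzProperty_lefschetzG hη).forall_sl2Rep_apply_eq_self_iff_mem_primitiveSpace_zero isZGrading_countingG x,
    mem_primitiveSpace_iff_exists_of hη (Nat.zero_le _), Nat.sub_zero]

/-- **`ρ(γ)(of g α) = of g α` for a middle primitive class `α ∈ Pᵍ(η)` and every `γ ∈ SL₂(ℂ)`.** [cite: Bourbaki2008LieGroups79, Ch. VIII §1 no. 4 Theorem 2 (iii)]
[cite: Beauville2010SL2, §5 Proposition (p. 6)] -/
theorem sl2Rep_of_eq_self_of_mem_primitiveForms (hη : ∀ v : E, v ≠ 0 → ∃ w : E, η ![v, w] ≠ 0) {α : E [⋀^Fin (finrank ℂ E)]→L[ℝ] ℂ}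
    (hα : α ∈ primitiveForms η (finrank ℂ E)) (γ : SL(2, ℂ)) :
    (hasLefschetzProperty_lefschetzG hη).sl2Rep isZGrading_countingG γ (GForm.of (finrank ℂ E) α) = GForm.of (finrank ℂ E) α :=
  (forall_sl2Rep_apply_eq_self_iff hη _).2 ⟨α, hα, rfl⟩ γ

/-- **`w(of g α) = of g α` for `α ∈ Pᵍ(η)`**: the Weyl operator (Beauville's `ℱ`, "`ℱ(z) = z`" for `q = r = 0`) fixes the middle primitive
classes. [cite: Beauville2010SL2, §5 Corollary (p. 6), q = r = 0] -/
theorem weylOperator_of_eq_self_of_mem_primitiveForms (hη : ∀ v : E, v ≠ 0 → ∃ w : E, η ![v, w] ≠ 0) {α : E [⋀^Fin (finrank ℂ E)]→L[ℝ] ℂ}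
    (hα : α ∈ primitiveForms η (finrank ℂ E)) :
    (hasLefschetzProperty_lefschetzG hη).weylOperator isZGrading_countingG (GForm.of (finrank ℂ E) α) = GForm.of (finrank ℂ E) α := by
  rw [← (hasLefschetzProperty_lefschetzG hη).sl2Rep_apply_of_coe_eq_weyl isZGrading_countingG
    (⟨!![(0 : ℂ), -1; 1, 0], by rw [Matrix.det_fin_two_of]; ring⟩ : SL(2, ℂ)) rfl]
  exact sl2Rep_of_eq_self_of_mem_primitiveForms hη hα _

/-- **"`g + s − 2p ≥ 0`": no lowest weight vectors above the middle degree** — `Λ_η(of k α) = 0` with `k > g` forces `α = 0`.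
[cite: Beauville2010SL2, §5 Proposition (p. 6)] [cite: Hall2015, §4.6 Thm. 4.32] -/
theorem eq_zero_of_lefschetzDualG_of_eq_zero_of_lt (hη : ∀ v : E, v ≠ 0 → ∃ w : E, η ![v, w] ≠ 0) {k : ℕ} (hk : finrank ℂ E < k)
    {α : E [⋀^Fin k]→L[ℝ] ℂ} (h0 : lefschetzDualG η (GForm.of k α) = 0) : α = 0 := by
  rw [← dual_lefschetzG_eq_lefschetzDualG hη] at h0
  have h := (hasLefschetzProperty_lefschetzG hη).eq_zero_of_dual_apply_eq_zero_of_pos isZGrading_countingG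
    (m := (k : ℤ) - (finrank ℂ E : ℤ)) (by omega) (of_mem_degreeSpace_countingG k α) h0
  exact GForm.of_eq_zero_iff.1 h

/-- **`Λ_η(of k α) = 0 ⟺ α ∈ Pᵏ(η)`** for `k ≤ g` ("primitive if `θ^{g−1} ∗ z = 0`"; the tree's `Pᵏ(η) = ker(η^{∧(g−k+1)} ∧ ·)`).
[cite: Beauville2010SL2, §5 (p. 6)] [cite: HuybrechtsCG2005, §1.2 Prop. 1.2.30 (ii)] -/
theorem lefschetzDualG_of_eq_zero_iff (hη : ∀ v : E, v ≠ 0 → ∃ w : E, η ![v, w] ≠ 0) {k : ℕ} (hk : k ≤ finrank ℂ E)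
    (α : E [⋀^Fin k]→L[ℝ] ℂ) : lefschetzDualG η (GForm.of k α) = 0 ↔ α ∈ primitiveForms η k := by
  rw [← of_mem_primitiveSpace_iff_lefschetzDualG_eq_zero hη (show k + (finrank ℂ E - k) = finrank ℂ E by omega),
    of_mem_primitiveSpace_iff_mem_primitiveForms hη (show k + (finrank ℂ E - k) = finrank ℂ E by omega)]

/-- **"The primitive elements are exactly the lowest weight elements for the action of `SL₂`"**: `Λ_η x = 0` iff every component of
degree `m ≤ g` is primitive and every component of degree `m > g` vanishes (`Λ_η` is graded; `ker Λ = ⊕ₖ P_{−k}`).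
[cite: Beauville2010SL2, §5 (p. 6)] [cite: Bourbaki2008LieGroups79, Ch. VIII §1 no. 3 Proposition 4] -/
theorem lefschetzDualG_apply_eq_zero_iff (hη : ∀ v : E, v ≠ 0 → ∃ w : E, η ![v, w] ≠ 0) (x : GForm E ℂ) :
    lefschetzDualG η x = 0 ↔ (∀ m ≤ finrank ℂ E, x m ∈ primitiveForms η m) ∧ ∀ m, finrank ℂ E < m → x m = 0 := by
  -- `Λ_η` is graded: `Λ x = 0` iff `Λ (of m (x m)) = 0` for every `m`
  have hcomp : lefschetzDualG η x = 0 ↔ ∀ m, lefschetzDualG η (GForm.of m (x m)) = 0 := by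
    constructor
    · intro h m
      match m with
      | 0 => exact lefschetzDualG_of_of_lt_two η (by omega) _
      | 1 => exact lefschetzDualG_of_of_lt_two η (by omega) _
      | m + 2 =>
        rw [lefschetzDualG_of_add_two, ← lefschetzDualG_apply, h]
        all_goals simp [GForm.of_zero]
    · intro h
      funext m
      have hm := congr_fun (h (m + 2)) m
      rw [lefschetzDualG_of_add_two, GForm.of_apply_self] at hm
      rw [lefschetzDualG_apply, hm]
  rw [hcomp]
  constructor
  · intro h
    refine ⟨fun m hm ↦ (lefschetzDualG_of_eq_zero_iff hη hm (x m)).1 (h m), fun m hm ↦ eq_zero_of_lefschetzDualG_of_eq_zero_of_lt hη hm (h m)⟩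
  · rintro ⟨hP, h0⟩ m
    rcases le_or_gt m (finrank ℂ E) with hm | hm
    · exact (lefschetzDualG_of_eq_zero_iff hη hm (x m)).2 (hP m hm)
    · rw [h0 m hm, GForm.of_zero, map_zero]

/-- **At group level: `x` is fixed by every lower unipotent `ρ(1 0 ; a 1) = exp(a Λ_η)` iff `Λ_η x = 0`** (iff `x` is a sum of primitive
classes of degrees `≤ g`, by `lefschetzDualG_apply_eq_zero_iff`). [cite: Beauville2010SL2, §4 Theorem and §5 (p. 6)] -/
theorem forall_sl2Rep_lower_apply_eq_self_iff (hη : ∀ v : E, v ≠ 0 → ∃ w : E, η ![v, w] ≠ 0) (x : GForm E ℂ) :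
    (∀ (γ : SL(2, ℂ)) (a : ℂ), (γ : Matrix (Fin 2) (Fin 2) ℂ) = !![1, 0; a, 1] →
        (hasLefschetzProperty_lefschetzG hη).sl2Rep isZGrading_countingG γ x = x) ↔ lefschetzDualG η x = 0 := by
  rw [← dual_lefschetzG_eq_lefschetzDualG hη]
  refine ⟨fun H ↦ ?_, fun h γ a hγ ↦ (hasLefschetzProperty_lefschetzG hη).sl2Rep_apply_eq_self_of_dual_apply_eq_zero isZGrading_countingG h γ hγ⟩
  exact (hasLefschetzProperty_lefschetzG hη).dual_apply_eq_zero_of_sl2Rep_apply_eq_self isZGrading_countingG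
    (⟨!![(1 : ℂ), 0; 1, 1], by rw [Matrix.det_fin_two_of]; ring⟩ : SL(2, ℂ)) one_ne_zero rfl (H _ 1 rfl)

end Invariants

end ComplexTorus

end Literature.Geometry.Kaehler

end
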